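import Summits.HodgeConjecture.CorCM.Census.OcticCurveFourfoldParts
import HarnessLib

/-!
# `B × E` for a SIMPLE CM abelian fourfold `B` of WEIL TYPE — octic CM field `F ⊇ k`, type of `k`-signature `(2,2)` —
# and the CM curve `E` of `k`: the balanced weights of EVERY product of copies are lifted conjugate pairs and lifted
# Weil `4`-sets of `B` (kernel census, 10-point model)

COR-CM (cell `pub-hodgecm2`), seat b30 gen 19 (2026-08-21); count-neutral own lane OCTIC-WEIL22, the item left open by
gen 18's OCTIC-EB (`Census/OcticCurveFourfold{,Parts}`: `k`-signature `(1,3)`).  Bookkeeping definitions and theorems of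
a finite model; no named fact, no geometry, no `sorry`.  The 10-point model `Pt = Bool ⊕ (Fin 4 × Bool)`, its conjugation
`cj`, the counting lemmas and the PAIR PARTS of `Census/OcticCurveFourfold(Parts)` are reused by name.

SETTING (formalised downstream, `CorCM/OcticWeilFourfoldFrameTransfer.lean`).  `F` a CM field of degree `8` containing
the imaginary quadratic field `k` (`i : k → F`), `τ : k → ℂ`, `E ⊨ (k; {τ})`, and `B ⊨ (F; Φ)` a CM abelian fourfold
whose type has `k`-SIGNATURE `(2,2)`: exactly two members `s₁, s₂` of `Φ` restrict to `τ` (so `B` is an abelian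
fourfold of Weil type for `k`, with Weil classes `W_k(B) = ⋀⁴_k H¹(B; ℚ)`), AND `B` SIMPLE.  By Dodson 1984 §3.3.2
(tree: `DegenerateOcticCMTypesSexticReflex`, `OcticCMFieldsWithDegenerateTypes`) simplicity forces
`Gal(Fᶜ/ℚ) ≅ ℤ₂ × A₄` or `ℤ₂ × S₄`, i.e. `Aut(ℂ/k)` acts `2`-TRANSITIVELY on the four embeddings of `F` over `τ`; these
`B` are the DEGENERATE simple CM abelian fourfolds (Mumford–Pohlmann).  The `2`-transitivity is the only input here.

MODEL.  `inl b` = the embedding of `k` of sign `b` (`true = τ`); `inr (a, b)` = the embedding of `F` of sign `b` in the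
`a`-th conjugate pair, numbered so that `Φ = {(0,true), (1,true), (2,false), (3,false)}` (`phi₂`).  For `ρ ∈ Aut(ℂ)`
FIXING `τ` with `ρ⁻¹ s₁, ρ⁻¹ s₂` in the pairs `a ≠ b`, `ρ⁻¹Φ = phi₂Pre a b = {inl true, (a,true), (b,true)} ⊔
{(c,false) | c ∉ {a,b}}`; by `2`-transitivity all twelve ordered pairs `(a,b)` occur.  A configuration `(T, v)` (a weight
of a product of copies, `v` the copy-forgetting model map) is balanced iff `2 · #{x ∈ T | v x ∈ phi₂Pre a b} = |T|` for
all `a ≠ b` (`ModelBalanced₂ v T`).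

RESULTS (kernel).
* `two_mul_sum_phi₂Pre_add` — the twelve sums expanded; `modelBalanced₂_iff_counts` — balance depends on the ten counts;
* **`defect₂_iff_counts` / `exists_defect₂_of_modelBalanced₂`** — THE DEFECT LAW: `N(inl true) = N(inl false)` and
  there is ONE integer `t` with `N(inr (a,true)) − N(inr (a,false)) = t` for all four `a` (the Hodge lattice of the whole
  `{B, E}`-slice is `⟨5 conjugate pairs⟩ ⊕ ℤ·w`, `w = Σ_a [(a, τ)]` the weight of `W_k(B)`: the CURVE ENTERS THROUGH
  DIVISORS ONLY — contrast gen 18's `(1,3)` law `N(inl true) − N(inl false) = 2t`);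
* the sequel `Census/OcticWeilFourfoldParts.lean` extracts the generating parts (pair parts of
  `Census/OcticCurveFourfoldParts`; Weil parts = one point over each of the four labels `(a, b)`, none over the curve)
  and proves the induction principle.
[cite: Pohlmann1968, Thm 1] [cite: GaoUllmo2025, Thm 3.1] [cite: Dodson1984, §3.3.2 Theorem]
[cite: MoonenZarhin1995Duke, Thm. 2.4] [cite: Gordon1999HodgeAVSurvey, 5.13 (ii)]

## References
* [Pohlmann1968] H. Pohlmann, Ann. of Math. 88 (1968), Thm 1.  [GaoUllmo2025] Z. Gao, E. Ullmo, J. Inst. Math. Jussieu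
  25 (2025), Thm 3.1 (3.2).  [Dodson1984] B. Dodson, Trans. AMS 283 (1984), §3.3.2 Theorem.  [MoonenZarhin1995Duke]
  B. Moonen, Yu. Zarhin, Duke Math. J. 77 (1995), Thm. 2.4.  [Gordon1999HodgeAVSurvey] B. B. Gordon, CRM Monogr. 10
  (1999), 5.13 (ii), §9.2.  [Markman2025SurveySecant] E. Markman, arXiv:2509.23403, Thm. 1.2 (fourfolds).

## Provenance
Exact python first (seat folder `work/scratch/weil22_census.py`): on all count vectors with entries `≤ 3` the twelve
equations hold iff the defect law holds (`1808` balanced vectors, `0` mismatches); and for the transitive subgroups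
`H⁺ ≤ S₄` of the quartic part: the `(2,2)` types are primitive iff `H⁺ ∈ {A₄, S₄}` (then the balanced space modulo pairs
has rank `1`), induced with rank `2`–`3` for `C₄, V₄, D₄`.
-/

namespace Summit.HodgeConjecture.CorCM.Census.OcticWeilFourfold

open Finset
open Summit.HodgeConjecture.CorCM.Census.OcticCurveFourfold (Pt sgn cj cj_inl cj_inr cj_facts fin4_cases
  card_filter_mem_eq_sum card_eq_sum sum_pt IsPairPart exists_pairPart_of_counts)

/-! ### The twelve translates of the type -/

/-- **`ρ⁻¹Φ` read in the model** (Boolean form), for `ρ ∈ Aut(ℂ)` fixing `τ` with `ρ⁻¹s₁`, `ρ⁻¹s₂` in the conjugate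
pairs `a`, `b`: the labels of sign `true` in the pairs `a, b`, the labels of sign `false` in the other pairs, and `τ` on
the curve. [cite: GaoUllmo2025, Thm 3.1 (3.2)] -/
def inPhi₂Pre (a b : Fin 4) : Pt → Bool
  | Sum.inl c => c
  | Sum.inr q => (q.2 && (q.1 == a || q.1 == b)) || (!q.2 && !(q.1 == a) && !(q.1 == b))

/-- `ρ⁻¹Φ` as a finset of the model. [cite: GaoUllmo2025, Thm 3.1 (3.2)] -/
def phi₂Pre (a b : Fin 4) : Finset Pt := univ.filter fun y => inPhi₂Pre a b y = true

/-- The CM type of `B × E` itself: `ρ = 1`, pairs `0, 1`. [folklore] -/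
def phi₂ : Finset Pt := phi₂Pre 0 1

/-- Membership in `phi₂Pre a b` is the Boolean test. [folklore] -/
theorem mem_phi₂Pre_iff (a b : Fin 4) (y : Pt) : y ∈ phi₂Pre a b ↔ inPhi₂Pre a b y = true := by
  simp [phi₂Pre]

/-- Membership in `phi₂Pre a b`, curve slot: the embedding over `τ`, whatever `a, b`. [folklore] -/
theorem inl_mem_phi₂Pre (a b : Fin 4) (c : Bool) : Sum.inl c ∈ phi₂Pre a b ↔ c = true := by
  rw [mem_phi₂Pre_iff, inPhi₂Pre]

/-- Membership in `phi₂Pre a b`, fourfold slot. [folklore] -/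
theorem inr_mem_phi₂Pre (a b : Fin 4) (q : Fin 4 × Bool) :
    Sum.inr q ∈ phi₂Pre a b ↔ (q.2 = true ∧ (q.1 = a ∨ q.1 = b)) ∨ (q.2 = false ∧ q.1 ≠ a ∧ q.1 ≠ b) := by
  rw [mem_phi₂Pre_iff, inPhi₂Pre]
  cases q.2 <;> simp

/-- `phi₂ = {inl true, inr (0,true), inr (1,true), inr (2,false), inr (3,false)}`: two labels over `τ`, two over `τ̄`
(`k`-signature `(2,2)`), and `τ` on the curve. [folklore] -/
theorem phi₂_eq : phi₂ = {Sum.inl true, Sum.inr (0, true), Sum.inr (1, true), Sum.inr (2, false), Sum.inr (3, false)} := by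
  decide +kernel

/-- `phi₂Pre` is symmetric in the two pairs. [folklore] -/
theorem phi₂Pre_comm : ∀ a b : Fin 4, phi₂Pre a b = phi₂Pre b a := by decide +kernel

/-- Each `phi₂Pre a b` (`a ≠ b`) is a CM type of the model: exactly one of `y`, `cj y`; five points. [folklore] -/
theorem phi₂Pre_isCMType :
    ∀ a b : Fin 4, a ≠ b → (∀ y : Pt, (y ∈ phi₂Pre a b ↔ cj y ∉ phi₂Pre a b)) ∧ (phi₂Pre a b).card = 5 := by
  decide +kernel

/-- `phi₂Pre a b` as an explicit finset: `{inl true, (a,true), (b,true)} ∪ {(c,false) | c ≠ a, c ≠ b}`. [folklore] -/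
theorem phi₂Pre_eq : ∀ a b : Fin 4, a ≠ b → phi₂Pre a b =
    insert (Sum.inl true) (insert (Sum.inr (a, true)) (insert (Sum.inr (b, true))
      ((univ.filter fun c : Fin 4 => c ≠ a ∧ c ≠ b).image fun c => (Sum.inr (c, false) : Pt)))) := by
  decide +kernel

/-! ### Balanced configurations -/

variable {α : Type*}

/-- **Pohlmann's condition for a configuration** `(T, v)` under `2`-transitivity (a weight of a product of copies of
`B`, `E` read in the 10-point model, `v` = the copy-forgetting model map): for each ordered pair of distinct conjugate
pairs `(a, b)`, `2 · #{x ∈ T | v x ∈ ρ_{ab}⁻¹Φ} = |T|`. [cite: GaoUllmo2025, Thm 3.1 eq. (3.2)] [cite: Dodson1984, §3.3.2 Theorem] -/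
def ModelBalanced₂ (v : α → Pt) (T : Finset α) : Prop :=
  ∀ a b : Fin 4, a ≠ b → 2 * (T.filter fun x => v x ∈ phi₂Pre a b).card = T.card

variable (v : α → Pt)

/-- Unfolding. [cite: GaoUllmo2025, Thm 3.1 eq. (3.2)] -/
theorem modelBalanced₂_iff (T : Finset α) :
    ModelBalanced₂ v T ↔ ∀ a b : Fin 4, a ≠ b → 2 * (T.filter fun x => v x ∈ phi₂Pre a b).card = T.card :=
  Iff.rfl

/-- The empty configuration is balanced. [folklore] -/
theorem modelBalanced₂_empty : ModelBalanced₂ v (∅ : Finset α) := fun _ _ _ => by simp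

variable {v}

/-- **Removing a balanced part keeps the balance.** [folklore] -/
theorem ModelBalanced₂.sdiff [DecidableEq α] {T G : Finset α} (hT : ModelBalanced₂ v T) (hG : ModelBalanced₂ v G)
    (hGT : G ⊆ T) : ModelBalanced₂ v (T \ G) := by
  intro a b hab
  have key : ∀ (Q : α → Prop) [DecidablePred Q],
      ((T \ G).filter Q).card = (T.filter Q).card - (G.filter Q).card := by
    intro Q _
    rw [← Finset.card_sdiff_of_subset (Finset.filter_subset_filter Q hGT)]
    congr 1
    ext x
    simp only [Finset.mem_filter, Finset.mem_sdiff]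
    tauto
  have h1 := hT a b hab
  have h2 := hG a b hab
  have h3 := Finset.card_sdiff_of_subset hGT
  have h4 : (G.filter fun x => v x ∈ phi₂Pre a b).card ≤ (T.filter fun x => v x ∈ phi₂Pre a b).card :=
    Finset.card_le_card (Finset.filter_subset_filter _ hGT)
  rw [key, h3]
  omega

/-- The union of two disjoint balanced configurations is balanced. [folklore] -/
theorem ModelBalanced₂.union [DecidableEq α] {G R : Finset α} (hG : ModelBalanced₂ v G) (hR : ModelBalanced₂ v R)
    (hGR : Disjoint G R) : ModelBalanced₂ v (G ∪ R) := by
  intro a b hab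
  rw [Finset.filter_union, Finset.card_union_of_disjoint (Finset.disjoint_filter_filter hGR),
    Finset.card_union_of_disjoint hGR, mul_add, hG a b hab, hR a b hab]

/-! ### Counting fibrewise: balance depends only on the ten counts -/

variable (v)

/-- **Balance read on the counts**: `(T, v)` is balanced iff its count function `N(y) = #{x ∈ T | v x = y}` satisfies
`2 Σ_{y ∈ phi₂Pre a b} N(y) = Σ_y N(y)` for the twelve `(a, b)`. [cite: GaoUllmo2025, Thm 3.1] -/
theorem modelBalanced₂_iff_counts (T : Finset α) : ModelBalanced₂ v T ↔ ∀ a b : Fin 4, a ≠ b →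
    2 * ∑ y ∈ phi₂Pre a b, (T.filter fun x => v x = y).card = ∑ y : Pt, (T.filter fun x => v x = y).card := by
  refine forall_congr' fun a => forall_congr' fun b => forall_congr' fun _ => ?_
  rw [card_filter_mem_eq_sum, card_eq_sum v T]

/-- **The twelve sums `Σ_{y ∈ phi₂Pre a b} N y`, expanded**:
`Σ_{y ∈ phi₂Pre a b} N y + N(a,false) + N(b,false) = N(inl true) + N(a,true) + N(b,true) + Σ_c N(c,false)`. [folklore] -/
theorem sum_phi₂Pre_add (N : Pt → ℕ) {a b : Fin 4} (hab : a ≠ b) :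
    ∑ y ∈ phi₂Pre a b, N y + N (Sum.inr (a, false)) + N (Sum.inr (b, false)) =
      N (Sum.inl true) + N (Sum.inr (a, true)) + N (Sum.inr (b, true)) + ∑ c : Fin 4, N (Sum.inr (c, false)) := by
  classical
  rw [phi₂Pre_eq a b hab]
  have hinj : Function.Injective fun c : Fin 4 => (Sum.inr (c, false) : Pt) := fun c c' h => by
    simpa using h
  have h3 : Sum.inr (b, true) ∉ (univ.filter fun c : Fin 4 => c ≠ a ∧ c ≠ b).image
      fun c => (Sum.inr (c, false) : Pt) := by simp
  have h2 : Sum.inr (a, true) ∉ insert (Sum.inr (b, true)) ((univ.filter fun c : Fin 4 => c ≠ a ∧ c ≠ b).image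
      fun c => (Sum.inr (c, false) : Pt)) := by
    simp [hab]
  have h1 : Sum.inl true ∉ insert (Sum.inr (a, true)) (insert (Sum.inr (b, true))
      ((univ.filter fun c : Fin 4 => c ≠ a ∧ c ≠ b).image fun c => (Sum.inr (c, false) : Pt))) := by simp
  rw [Finset.sum_insert h1, Finset.sum_insert h2, Finset.sum_insert h3, Finset.sum_image fun c _ c' _ h => hinj h]
  -- the complement `{a, b}` of the filter
  have hsplit := Finset.sum_filter_add_sum_filter_not (univ : Finset (Fin 4)) (fun c => c ≠ a ∧ c ≠ b)
    (fun c => N (Sum.inr (c, false)))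
  have hrest : ∑ c ∈ univ.filter (fun c : Fin 4 => ¬(c ≠ a ∧ c ≠ b)), N (Sum.inr (c, false)) =
      N (Sum.inr (a, false)) + N (Sum.inr (b, false)) := by
    have : univ.filter (fun c : Fin 4 => ¬(c ≠ a ∧ c ≠ b)) = {a, b} := by
      ext c
      simp only [Finset.mem_filter, Finset.mem_univ, true_and, Finset.mem_insert, Finset.mem_singleton]
      tauto
    rw [this, Finset.sum_pair hab]
  rw [← hsplit, hrest]
  ring

/-- **THE DEFECT LAW, on counts.**  `N : Pt → ℕ` satisfies the twelve balance equations iff `N(inl true) = N(inl false)`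
and for ONE integer `t`: `N(inr (a,true)) − N(inr (a,false)) = t` for `a = 0, 1, 2, 3`.  (The equations of `(0,1)` and
`(2,3)` add up to `N(inl true) = N(inl false)`; then `d_a = N(a,true) − N(a,false)` has `d₀ + d₁ = d₂ + d₃`,
`d₀ + d₂ = d₁ + d₃`, `d₀ + d₃ = d₁ + d₂`, so all `d_a` are equal.) [cite: GaoUllmo2025, Thm 3.1] [cite: Pohlmann1968, Thm 1]
[cite: Gordon1999HodgeAVSurvey, 5.13 (ii)] -/
theorem defect₂_iff_counts (N : Pt → ℕ) :
    (∀ a b : Fin 4, a ≠ b → 2 * ∑ y ∈ phi₂Pre a b, N y = ∑ y : Pt, N y) ↔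
      N (Sum.inl true) = N (Sum.inl false) ∧
        ∃ t : ℤ, ∀ a : Fin 4, (N (Sum.inr (a, true)) : ℤ) - N (Sum.inr (a, false)) = t := by
  have htot := sum_pt N
  have hS : ∑ c : Fin 4, N (Sum.inr (c, false)) =
      N (Sum.inr (0, false)) + N (Sum.inr (1, false)) + N (Sum.inr (2, false)) + N (Sum.inr (3, false)) := by
    rw [Fin.sum_univ_four]
  have hexp : ∀ a b : Fin 4, a ≠ b → ∑ y ∈ phi₂Pre a b, N y + N (Sum.inr (a, false)) + N (Sum.inr (b, false)) =
      N (Sum.inl true) + N (Sum.inr (a, true)) + N (Sum.inr (b, true)) +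
        (N (Sum.inr (0, false)) + N (Sum.inr (1, false)) + N (Sum.inr (2, false)) + N (Sum.inr (3, false))) :=
    fun a b hab => by rw [sum_phi₂Pre_add N hab, hS]
  constructor
  · intro h
    have e01 := h 0 1 (by decide); have e23 := h 2 3 (by decide); have e02 := h 0 2 (by decide)
    have e13 := h 1 3 (by decide); have e03 := h 0 3 (by decide)
    have x01 := hexp 0 1 (by decide); have x23 := hexp 2 3 (by decide); have x02 := hexp 0 2 (by decide)
    have x13 := hexp 1 3 (by decide); have x03 := hexp 0 3 (by decide)
    rw [htot] at e01 e23 e02 e13 e03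
    refine ⟨by omega, (N (Sum.inr (0, true)) : ℤ) - N (Sum.inr (0, false)), fun a => ?_⟩
    rcases fin4_cases a with rfl | rfl | rfl | rfl <;> omega
  · rintro ⟨hE, t, hB⟩ a b hab
    have hB0 := hB 0; have hB1 := hB 1; have hB2 := hB 2; have hB3 := hB 3
    have x := hexp a b hab
    rw [htot]
    rcases fin4_cases a with rfl | rfl | rfl | rfl <;> rcases fin4_cases b with rfl | rfl | rfl | rfl <;>
      first | exact absurd rfl hab | omega

variable {v}

/-- **THE DEFECT LAW of a balanced configuration.**  With `N(y) = #{x ∈ T | v x = y}`: `N(inl true) = N(inl false)` and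
there is ONE integer `t` with `N(inr (a,true)) − N(inr (a,false)) = t` for all `a`: every balanced weight of every product
of copies of `B`, `E` is `Σ (conjugate pairs) + t · w`, `w = Σ_a [(a,τ)]` the weight of the Weil line `⋀⁴_k H¹(B)_τ`.
[cite: GaoUllmo2025, Thm 3.1] [cite: Gordon1999HodgeAVSurvey, 5.13 (ii)] [cite: Markman2025SurveySecant, Thm. 1.2] -/
theorem exists_defect₂_of_modelBalanced₂ {T : Finset α} (hT : ModelBalanced₂ v T) :
    (T.filter fun x => v x = Sum.inl true).card = (T.filter fun x => v x = Sum.inl false).card ∧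
      ∃ t : ℤ, ∀ a : Fin 4, ((T.filter fun x => v x = Sum.inr (a, true)).card : ℤ) -
        (T.filter fun x => v x = Sum.inr (a, false)).card = t :=
  (defect₂_iff_counts fun y => (T.filter fun x => v x = y).card).1 ((modelBalanced₂_iff_counts v T).1 hT)

/-- Conversely, counts obeying the defect law are balanced. [cite: GaoUllmo2025, Thm 3.1] -/
theorem modelBalanced₂_of_defect₂ {T : Finset α} (t : ℤ)
    (hE : (T.filter fun x => v x = Sum.inl true).card = (T.filter fun x => v x = Sum.inl false).card)
    (hB : ∀ a : Fin 4, ((T.filter fun x => v x = Sum.inr (a, true)).card : ℤ) -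
      (T.filter fun x => v x = Sum.inr (a, false)).card = t) : ModelBalanced₂ v T :=
  (modelBalanced₂_iff_counts v T).2 ((defect₂_iff_counts fun y => (T.filter fun x => v x = y).card).2 ⟨hE, t, hB⟩)

end Summit.HodgeConjecture.CorCM.Census.OcticWeilFourfold
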